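import Literature.Geometry.Lorentzian.NearKerrLeaf
import Literature.Geometry.Lorentzian.KerrConvergenceProofs
import Literature.Geometry.Lorentzian.SpacetimeMetricInCoordsCalculus
import Literature.Geometry.Lorentzian.SpacetimeLocalConvergenceChartTransport
import HarnessLib

/-!
# `stub_starChartExtension`: the eternal rest-frame Kerr-star chart as a total map on `E4`
(crux `GapExhaustion`, stmt-FinalStateConjecture-10808, line photon-shell-pseudoconvexity;
stub (W2-B) `stub_starChartExtension`, node glue)

The rigidity node of the line is stated for an ETERNAL rest-frame Kerr-star chart
`Ψ : (starBackground 1 0 M a (Kerr.radius a)).domain → 𝓢` — a map on the open SUBTYPE of the star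
domain `{r > max M 0}` — with nearness measured by `𝓢.deviationExtend … Ψ` and its coordinate
derivatives, whereas the landed chart-level theorems of the line (pseudo-convexity margins,
multiplier forms, Killing patching, escape, sweep) are stated for a TOTAL map `Φ : E4 → 𝓢`,
smooth on `{z | M < Kerr.radius a z}`, with closeness measured by
`𝓢.metricInCoords Φ z − Kerr.bilin M a z` and its derivatives. This file is the dictionary between
the two vocabularies:

* extend `Ψ` to a total representative `Φ` (`Spacetime.LocalSubconvergence.chartExtend`, junk
  value off the domain), `Φ ↑x = Ψ x`;
* for `0 < M` and the trivial motion `(Λ, c) = (1, 0)` (`poincareInv_one_zero`) the star domain IS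
  `{z | M < Kerr.radius a z}` (`max M 0 = M`);
* smoothness of `Ψ` on the open submanifold is smoothness of `Φ` on the open set (Mathlib
  `contMDiffAt_subtype_iff`), and `{M < r}.restrict Φ = Ψ` is the given open embedding;
* `𝓢.metricInCoords Φ ↑x = 𝓢.deviation B Ψ x + g_{M,a}(↑x)` on the domain
  (`Spacetime.pullbackBilin_comp_subtypeVal_eq_metricInCoords`, `boostedKerrBilin_one_zero`), hence
  `metricInCoords Φ − g_{M,a}` and `deviationExtend B Ψ` have the same germ, and so the same
  iterated Fréchet derivatives, at every point of the (open) domain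
  (`Filter.EventuallyEq.iteratedFDeriv`).

All of this is folklore calculus on open submanifolds of `E4` (O'Neill 1983, Ch. 1, p. 4; Ch. 3,
Def. 3.9); the Kerr-star chart itself is that of Dafermos–Rodnianski, arXiv:0811.0354, §5.1.
-/

noncomputable section

-- instance search through the nested operator types `E4 →L[ℝ] E4 →L[ℝ] ℝ`
set_option maxSynthPendingDepth 3

-- D-0017: single-problem summit, `Summit.<S>.<S>.…` by design (cf. lakefile `weak.linter.dupNamespace`).
set_option linter.dupNamespace false

namespace Summit.FinalStateConjecture.FinalStateConjecture.Theorems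

open Set Literature.Geometry.Lorentzian
open scoped Manifold ContDiff Topology

universe u

/-- **Total representative of a smooth chart map over a model background.** For a `C^∞` chart map
`Ψ : B.domain → 𝓢` on the (open) domain of a `ModelBackground` there is a total map
`Φ : E4 → 𝓢` with `Φ ↑x = Ψ x`, `C^∞` (into the manifold) at every point of the domain, whose
metric components are `𝓢.metricInCoords Φ y = (Ψ^* g − g₀)(y) + g₀(y)` on the domain
(`Spacetime.LocalSubconvergence.chartExtend`, Mathlib `contMDiffAt_subtype_iff`,
`Spacetime.pullbackBilin_comp_subtypeVal_eq_metricInCoords`). O'Neill 1983, Ch. 1, p. 4 and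
Ch. 3, Def. 3.9 (open submanifolds, pullback). [folklore] -/
private theorem starChartExt_exists_rep (𝓢 : Spacetime.{u} 4) (B : ModelBackground)
    (Ψ : B.domain → 𝓢.carrier) (hΨ : ContMDiff 𝓘(ℝ, E4) (𝓡 4) ∞ Ψ) :
    ∃ Φ : E4 → 𝓢.carrier, (∀ x : B.domain, Φ x.1 = Ψ x) ∧
      (∀ y ∈ (B.domain : Set E4), ContMDiffAt 𝓘(ℝ, E4) (𝓡 4) ∞ Φ y) ∧
      (∀ x : B.domain, 𝓢.metricInCoords Φ x.1 = 𝓢.deviation B Ψ x + B.bilin x.1) := by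
  set Φ : E4 → 𝓢.carrier :=
    Spacetime.LocalSubconvergence.chartExtend B Ψ (Classical.arbitrary 𝓢.carrier) with hΦ
  have hΦΨ : ∀ x : B.domain, Φ x.1 = Ψ x :=
    Spacetime.LocalSubconvergence.chartExtend_coe B Ψ _
  have hat : ∀ y ∈ (B.domain : Set E4), ContMDiffAt 𝓘(ℝ, E4) (𝓡 4) ∞ Φ y := fun y hy ↦
    (Spacetime.LocalSubconvergence.contMDiffAt_opens_iff_of_eq (fun z ↦ (hΦΨ z).symm) ⟨y, hy⟩).1
      (hΨ ⟨y, hy⟩)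
  refine ⟨Φ, hΦΨ, hat, fun x ↦ ?_⟩
  have hfun : Φ ∘ Subtype.val = Ψ := funext hΦΨ
  have key := 𝓢.pullbackBilin_comp_subtypeVal_eq_metricInCoords (U := B.domain) (ψ := Φ) x
    ((hat x.1 x.2).mdifferentiableAt (by simp))
  rw [hfun] at key
  rw [← key, Spacetime.deviation, sub_add_cancel]

/-- **(W2-B) The eternal rest-frame star chart as a total map on `E4`.** For `0 < M` and a `C^∞`
open embedding `Ψ` of the rest-frame Kerr-star domain `(starBackground 1 0 M a (Kerr.radius a)).domain
= {r_{a} > max M 0}` into a spacetime `𝓢`, there is a total map `Φ : E4 → 𝓢` extending `Ψ`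
(`Φ ↑x = Ψ x`), the domain is `{z | M < Kerr.radius a z}`, `Φ` is `C^∞` on it, its restriction to
it is the open embedding `Ψ`, and on the domain
`𝓢.metricInCoords Φ = 𝓢.deviation B Ψ + g_{M,a}` together with ALL iterated coordinate derivatives
of `metricInCoords Φ − g_{M,a}` versus `deviationExtend B Ψ` (same germ on the open domain).
Kerr-star chart: Dafermos–Rodnianski, arXiv:0811.0354, §5.1; open-submanifold calculus:
O'Neill 1983, Ch. 1, p. 4 and Ch. 3, Def. 3.9. [folklore] -/
theorem stub_starChartExtension :
    ∀ (𝓢 : Spacetime.{0} 4) (M a : ℝ)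
      (Ψ : (starBackground 1 0 M a (Kerr.radius a)).domain → 𝓢.carrier), 0 < M →
      ContMDiff 𝓘(ℝ, E4) (𝓡 4) ∞ Ψ → Topology.IsOpenEmbedding Ψ →
      ∃ Φ : E4 → 𝓢.carrier,
        (∀ x : (starBackground 1 0 M a (Kerr.radius a)).domain, Φ x.1 = Ψ x) ∧
        {z : E4 | M < Kerr.radius a z} = ((starBackground 1 0 M a (Kerr.radius a)).domain : Set E4) ∧
        ContMDiffOn 𝓘(ℝ, E4) (𝓡 4) ∞ Φ {z | M < Kerr.radius a z} ∧
        Topology.IsOpenEmbedding ({z : E4 | M < Kerr.radius a z}.restrict Φ) ∧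
        (∀ x : (starBackground 1 0 M a (Kerr.radius a)).domain,
          𝓢.metricInCoords Φ x.1 =
            𝓢.deviation (starBackground 1 0 M a (Kerr.radius a)) Ψ x + Kerr.bilin M a x.1) ∧
        (∀ (j : ℕ) (x : (starBackground 1 0 M a (Kerr.radius a)).domain),
          iteratedFDeriv ℝ j (fun z => 𝓢.metricInCoords Φ z - Kerr.bilin M a z) x.1 =
            iteratedFDeriv ℝ j (𝓢.deviationExtend (starBackground 1 0 M a (Kerr.radius a)) Ψ) x.1) := by
  intro 𝓢 M a Ψ hM hΨ hemb
  -- the star domain of the trivial motion is `{r > max M 0} = {r > M}`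
  have hset : {z : E4 | M < Kerr.radius a z} =
      ((starBackground 1 0 M a (Kerr.radius a)).domain : Set E4) := by
    ext z
    simp only [mem_setOf_eq, coe_starBackground_domain, mem_preimage, poincareInv_one_zero,
      SetLike.mem_coe, Kerr.mem_region, max_eq_left hM.le]
  obtain ⟨Φ, hΦΨ, hat, hdict⟩ :=
    starChartExt_exists_rep 𝓢 (starBackground 1 0 M a (Kerr.radius a)) Ψ hΨ
  refine ⟨Φ, hΦΨ, hset, ?_, ?_, ?_, ?_⟩
  · -- smoothness on the open set is smoothness of the restriction to the open submanifold
    rw [hset]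
    exact fun y hy ↦ (hat y hy).contMDiffWithinAt
  · -- the restriction of the representative to the domain IS `Ψ`
    have key : ∀ s : Set E4, s = ((starBackground 1 0 M a (Kerr.radius a)).domain : Set E4) →
        Topology.IsOpenEmbedding (s.restrict Φ) := by
      rintro s rfl
      have hr : ((starBackground 1 0 M a (Kerr.radius a)).domain : Set E4).restrict Φ = Ψ :=
        funext hΦΨ
      rw [hr]
      exact hemb
    exact key _ hset
  · -- `metricInCoords Φ = deviation + boostedKerrBilin 1 0 M a = deviation + g_{M,a}`
    intro x
    rw [hdict x, starBackground_bilin, boostedKerrBilin_one_zero]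
  · -- same germ on the open domain, hence the same iterated derivatives
    intro j x
    refine (Filter.EventuallyEq.iteratedFDeriv ℝ ?_ j).eq_of_nhds
    filter_upwards [(starBackground 1 0 M a (Kerr.radius a)).domain.isOpen.mem_nhds x.2] with z hz
    rw [hdict ⟨z, hz⟩, 𝓢.deviationExtend_coe _ Ψ ⟨z, hz⟩, starBackground_bilin,
      boostedKerrBilin_one_zero, add_sub_cancel_right]

end Summit.FinalStateConjecture.FinalStateConjecture.Theorems

end
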